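import Literature.Topology.FourManifolds.RegularSublevelSet
import Mathlib.Analysis.Calculus.LocalExtr.Basic
import Mathlib.Analysis.Normed.Module.Convex
import Mathlib.Topology.Algebra.Module.LocallyConvex
import HarnessLib

/-!
# The two sides of a connected regular level set in Euclidean space

Topic `Literature/Topology/FourManifolds` (level-set idiom of `EuclideanRegularDomain.lean`;
written for the fact seat of `Literature.Geometry.Riemannian.Sweeney2026_pscMeanConvex`, where
Lawson–Michelsohn's strong isotopy of the boundary of a compact domain `{F ≤ 0} ⊂ ℝ^{m+1}`,
extended to an ambient diffeomorphism `θ`, has to be shown to carry `{F ≤ 0}` onto the new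
domain `{F' ≤ 0}` from `θ {F = 0} = {F' = 0}` alone).  Everything here is **proved**;
elementary point-set topology, no algebraic topology (no Jordan–Brouwer theorem is used: the
defining functions provide the two local sides).

For a smooth `F : ℝᵏ⁺¹ → ℝ` whose zero set `Z = {F = 0}` is regular (`dF ≠ 0` on `Z`) and
connected:

* `exists_isOpen_isPreconnected_inter_setOf_lt` — the local picture at a point of `Z`
  (implicit function theorem, through the tree's straightening chart `exists_straighten`,
  Milnor 1965, Lemma 2.9): a neighbourhood `U` with `U ∩ {F < 0}` preconnected and every zero
  of `F` in `U` adherent to `U ∩ {F < 0}`;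
* `isPreconnected_setOf_lt_of_isConnected_setOf_eq` — **`{F < 0}` is preconnected** (and so is
  `{F > 0}`, `isPreconnected_setOf_pos_of_isConnected_setOf_eq`): every connected component of
  the open set `{F < 0}` accumulates at some zero of `F` (the ambient space is connected), the
  set of zeros at which it accumulates is open (local picture) and closed in the connected `Z`,
  hence is all of `Z`; and two components accumulating at the same zero coincide (local
  picture again);
* `image_setOf_le_eq_of_image_setOf_eq_eq` — consequently **a homeomorphism of `ℝᵏ⁺¹` carrying
  `{F = 0}` onto `{F' = 0}` carries `{F ≤ 0}` onto `{F' ≤ 0}`** when both sublevel sets are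
  compact (both zero sets regular, `{F = 0}` connected): the connected set `θ {F < 0}` lies in
  one of the two open sides of `{F' = 0}`, and boundedness singles out `{F' < 0}`.

## References

* J. Milnor, *Lectures on the h-cobordism theorem* (1965), Lemma 2.9 (regular functions look
  locally like a projection). [MilnorHCobordism1965]
* J. M. Lee, *Introduction to Smooth Manifolds*, 2nd ed. (2013), Prop. 5.47 (regular domains
  `{F ≤ 0}`). [LeeSmoothManifolds2013]
-/

noncomputable section

open Set Function Filter Metric
open scoped Topology ContDiff

namespace Literature.Topology.FourManifolds

variable {k : ℕ}

/-! ### The local picture at a regular zero -/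

/-- The open half-space `{y | 0 < y 0}` of `ℝᵏ⁺¹` is convex. [folklore] -/
theorem convex_setOf_apply_zero_pos : Convex ℝ {y : EuclideanSpace ℝ (Fin (k + 1)) | 0 < y 0} :=
  convex_halfSpace_gt ((EuclideanSpace.proj (0 : Fin (k + 1)) :
    EuclideanSpace ℝ (Fin (k + 1)) →L[ℝ] ℝ).toLinearMap.isLinear) 0

/-- **The local picture at a regular zero.** If `F : ℝᵏ⁺¹ → ℝ` is smooth, `F z = 0` and
`dF(z) ≠ 0`, there is an open neighbourhood `U` of `z` such that `U ∩ {F < 0}` is preconnected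
and every zero of `F` in `U` lies in the closure of `U ∩ {F < 0}`: in the straightening chart
`G` at `z` (`G q 0 = -F q`, the tree's `exists_straighten`), `U` is the preimage of a small ball
and `U ∩ {F < 0}` the image of its convex intersection with `{y | 0 < y 0}`.
[cite: MilnorHCobordism1965, Lemma 2.9] -/
theorem exists_isOpen_isPreconnected_inter_setOf_lt {F : EuclideanSpace ℝ (Fin (k + 1)) → ℝ}
    (hF : ContDiff ℝ ∞ F)    {z : EuclideanSpace ℝ (Fin (k + 1))} (hdz : fderiv ℝ F z ≠ 0) :
    ∃ U : Set (EuclideanSpace ℝ (Fin (k + 1))), IsOpen U ∧ z ∈ U ∧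
      IsPreconnected (U ∩ {x | F x < 0}) ∧
      ∀ z' ∈ U, F z' = 0 → z' ∈ closure (U ∩ {x | F x < 0}) := by
  obtain ⟨G, hzG, -, -, -, hG0⟩ :=
    exists_straighten isOpen_univ (mem_univ z) hF.contDiffOn hdz 0
  obtain ⟨r, hr, hball⟩ := Metric.isOpen_iff.1 G.open_target (G z) (G.map_source hzG)
  have heq : (G.source ∩ G ⁻¹' ball (G z) r) ∩ {x | F x < 0} =
      G.symm '' (ball (G z) r ∩ {y | 0 < y 0}) := by
    ext x
    constructor
    · rintro ⟨⟨hxs, hxb⟩, hxF⟩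
      refine ⟨G x, ⟨hxb, ?_⟩, G.left_inv hxs⟩
      have h0 : G x 0 = 0 - F x := hG0 x hxs
      show 0 < G x 0
      rw [h0]
      have : F x < 0 := hxF
      linarith
    · rintro ⟨y, ⟨hyb, hy0⟩, rfl⟩
      have hyt : y ∈ G.target := hball hyb
      have hxs : G.symm y ∈ G.source := G.map_target hyt
      refine ⟨⟨hxs, ?_⟩, ?_⟩
      · show G (G.symm y) ∈ ball (G z) r
        rw [G.right_inv hyt]
        exact hyb
      · have h0 : G (G.symm y) 0 = 0 - F (G.symm y) := hG0 (G.symm y) hxs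
        rw [G.right_inv hyt] at h0
        have : (0 : ℝ) < y 0 := hy0
        show F (G.symm y) < 0
        linarith
  refine ⟨G.source ∩ G ⁻¹' ball (G z) r, G.isOpen_inter_preimage isOpen_ball, ⟨hzG, ?_⟩,
    ?_, ?_⟩
  · show G z ∈ ball (G z) r
    exact mem_ball_self hr
  · rw [heq]
    have h1 : IsPreconnected (ball (G z) r ∩ {y : EuclideanSpace ℝ (Fin (k + 1)) | 0 < y 0}) :=
      ((convex_ball (G z) r).inter convex_setOf_apply_zero_pos).isPreconnected
    have h2 : ContinuousOn G.symm
        (ball (G z) r ∩ {y : EuclideanSpace ℝ (Fin (k + 1)) | 0 < y 0}) :=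
      G.continuousOn_symm.mono (inter_subset_left.trans hball)
    exact h1.image G.symm h2
  · rintro z' ⟨hz's, hz'b⟩ hFz'
    -- approach `G z'` inside the ball from the side `0 < y 0`
    have hy'0 : G z' 0 = 0 := by
      have h0 : G z' 0 = 0 - F z' := hG0 z' hz's
      rw [h0, hFz', sub_zero]
    have hγc : Tendsto
        (fun t : ℝ => G z' + t • EuclideanSpace.single (0 : Fin (k + 1)) (1 : ℝ))
        (𝓝[>] 0) (𝓝 (G z')) := by
      have hc : Continuous fun t : ℝ =>
          G z' + t • EuclideanSpace.single (0 : Fin (k + 1)) (1 : ℝ) := by fun_prop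
      have h := hc.tendsto 0
      rw [zero_smul, add_zero] at h
      exact tendsto_nhdsWithin_of_tendsto_nhds h
    have hlim : Tendsto (fun t : ℝ =>
        G.symm (G z' + t • EuclideanSpace.single (0 : Fin (k + 1)) (1 : ℝ)))
        (𝓝[>] 0) (𝓝 z') := by
      have hca : ContinuousAt G.symm (G z') := G.continuousAt_symm (G.map_source hz's)
      have h := hca.tendsto.comp hγc
      rw [G.left_inv hz's] at h
      exact h
    refine mem_closure_of_tendsto hlim ?_
    have hb : ∀ᶠ t : ℝ in 𝓝[>] 0,
        G z' + t • EuclideanSpace.single (0 : Fin (k + 1)) (1 : ℝ) ∈ ball (G z) r :=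
      hγc (isOpen_ball.mem_nhds hz'b)
    have hpos : ∀ᶠ t : ℝ in 𝓝[>] 0, 0 < t := eventually_mem_nhdsWithin
    filter_upwards [hb, hpos] with t htb htpos
    rw [heq]
    refine ⟨G z' + t • EuclideanSpace.single (0 : Fin (k + 1)) (1 : ℝ), ⟨htb, ?_⟩, rfl⟩
    show 0 < (G z' + t • EuclideanSpace.single (0 : Fin (k + 1)) (1 : ℝ)) 0
    rw [PiLp.add_apply, PiLp.smul_apply, PiLp.single_apply, if_pos rfl, hy'0,
      smul_eq_mul, mul_one, zero_add]
    exact htpos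

/-! ### `{F < 0}` and `{F > 0}` are connected -/

/-- **The negative side of a connected regular zero set is preconnected.** If `F : ℝᵏ⁺¹ → ℝ`
is smooth, `dF ≠ 0` on `Z = {F = 0}` and `Z` is connected (in particular nonempty), then
`{F < 0}` is preconnected.  Proof: for a component `C` of the open set `{F < 0}`, the set of
zeros adherent to `C` is nonempty (`ℝᵏ⁺¹` is connected and `C` is open, so `C` has a frontier
point, which is not in the open set `{F < 0}` by maximality of `C`), open in `Z` (local picture)
and closed, hence all of `Z`; two components are then adherent to a common zero and, by the
local picture, meet. [cite: LeeSmoothManifolds2013, Prop. 5.47] -/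
theorem isPreconnected_setOf_lt_of_isConnected_setOf_eq {F : EuclideanSpace ℝ (Fin (k + 1)) → ℝ}
    (hF : ContDiff ℝ ∞ F) (hreg : ∀ x, F x = 0 → fderiv ℝ F x ≠ 0)
    (hZ : IsConnected {x | F x = 0}) :
    IsPreconnected {x : EuclideanSpace ℝ (Fin (k + 1)) | F x < 0} := by
  set A : Set (EuclideanSpace ℝ (Fin (k + 1))) := {x | F x < 0} with hA
  set Z : Set (EuclideanSpace ℝ (Fin (k + 1))) := {x | F x = 0} with hZdef
  have hAo : IsOpen A := isOpen_lt hF.continuous continuous_const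
  have hAZ : ∀ x ∈ A, x ∉ Z := fun x (hx : F x < 0) (hx' : F x = 0) => by
    rw [hx'] at hx; exact lt_irrefl _ hx
  -- the local picture at every zero
  choose! U hUo hzU hUc hUcl using fun z (hz : z ∈ Z) =>
    exists_isOpen_isPreconnected_inter_setOf_lt hF (hreg z hz)
  -- a preconnected subset of `A` meeting a component lies in it
  have absorb : ∀ {S : Set (EuclideanSpace ℝ (Fin (k + 1)))}
      {a c : EuclideanSpace ℝ (Fin (k + 1))}, IsPreconnected S → S ⊆ A →
      c ∈ S → c ∈ connectedComponentIn A a → S ⊆ connectedComponentIn A a := by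
    intro S a c hS hSA hcS hc
    rw [connectedComponentIn_eq hc]
    exact hS.subset_connectedComponentIn hcS hSA
  -- every component of `A` is adherent to every zero
  have key : ∀ a ∈ A, Z ⊆ closure (connectedComponentIn A a) := by
    intro a ha
    set C := connectedComponentIn A a with hC
    have hCo : IsOpen C := hAo.connectedComponentIn
    have hCA : C ⊆ A := connectedComponentIn_subset _ _
    have haC : a ∈ C := mem_connectedComponentIn ha
    -- (i) some zero is adherent to `C`
    have hT : (Z ∩ closure C).Nonempty := by
      obtain ⟨z₀, hz₀⟩ := hZ.nonempty
      have hCne : C ≠ univ := fun h => hAZ z₀ (hCA (h.symm ▸ mem_univ z₀)) hz₀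
      have hncl : ¬ IsClosed C := fun hcl => by
        rcases isClopen_iff.1 ⟨hcl, hCo⟩ with h | h
        · exact (nonempty_iff_ne_empty.1 ⟨a, haC⟩) h
        · exact hCne h
      obtain ⟨q, hqcl, hqC⟩ : ∃ q, q ∈ closure C ∧ q ∉ C := by
        by_contra h
        push Not at h
        exact hncl (closure_subset_iff_isClosed.1 h)
      refine ⟨q, ?_, hqcl⟩
      have hq_le : F q ≤ 0 := by
        have hcl : closure C ⊆ {x | F x ≤ 0} :=
          (closure_mono (hCA.trans fun x (hx : F x < 0) => hx.le)).trans
            (isClosed_le hF.continuous continuous_const).closure_subset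
        exact hcl hqcl
      rcases hq_le.lt_or_eq with hlt | heq
      · exfalso
        obtain ⟨ε, hε, hεA⟩ := Metric.isOpen_iff.1 hAo q hlt
        obtain ⟨c, hcb, hcC⟩ := mem_closure_iff_nhds.1 hqcl _ (ball_mem_nhds q hε)
        have hsub : ball q ε ⊆ C := absorb (convex_ball q ε).isPreconnected hεA hcb hcC
        exact hqC (hsub (mem_ball_self hε))
      · exact heq
    -- (ii) the set of zeros adherent to `C` is open and closed in `Z`, hence all of `Z`
    have hTopen : ∀ z ∈ Z, z ∈ closure C → Z ∩ U z ⊆ closure C := by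
      intro z hz hzc z' ⟨hz', hz'U⟩
      -- `U z ∩ A` meets `C`, is preconnected, hence lies in `C`
      obtain ⟨c, hcU, hcC⟩ := mem_closure_iff_nhds.1 hzc _ ((hUo z hz).mem_nhds (hzU z hz))
      have hsub : U z ∩ A ⊆ C := absorb (hUc z hz) inter_subset_right ⟨hcU, hCA hcC⟩ hcC
      exact closure_mono hsub (hUcl z hz z' hz'U hz')
    intro z hz
    by_contra hzc
    -- separate `Z` by `u = ⋃ U z'` over adherent zeros and `v = (closure C)ᶜ`
    set u : Set (EuclideanSpace ℝ (Fin (k + 1))) := ⋃ z' ∈ Z ∩ closure C, U z' with hu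
    have huo : IsOpen u := isOpen_biUnion fun z' hz' => hUo z' hz'.1
    have hvo : IsOpen (closure C)ᶜ := isClosed_closure.isOpen_compl
    have hZuv : Z ⊆ u ∪ (closure C)ᶜ := by
      intro z' hz'
      by_cases h : z' ∈ closure C
      · exact Or.inl (mem_biUnion (show z' ∈ Z ∩ closure C from ⟨hz', h⟩) (hzU z' hz'))
      · exact Or.inr h
    have hZu : Z ∩ u ⊆ closure C := by
      rintro z' ⟨hz', hz'u⟩
      obtain ⟨z'', hz'', hz'U⟩ := mem_iUnion₂.1 hz'u
      exact hTopen z'' hz''.1 hz''.2 ⟨hz', hz'U⟩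
    have hempty : Z ∩ (u ∩ (closure C)ᶜ) = ∅ := by
      ext z'
      simp only [mem_inter_iff, mem_compl_iff, mem_empty_iff_false, iff_false, not_and,
        not_not]
      exact fun hz' hz'u => hZu ⟨hz', hz'u⟩
    rcases (isPreconnected_iff_subset_of_disjoint.1 hZ.isPreconnected) u (closure C)ᶜ huo hvo
      hZuv hempty with h | h
    · exact hzc (hZu ⟨hz, h hz⟩)
    · obtain ⟨q, hqZ, hqc⟩ := hT
      exact h hqZ hqc
  -- two components adherent to a common zero coincide; conclude
  obtain ⟨z, hz⟩ := hZ.nonempty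
  refine isPreconnected_of_forall_pair fun a ha b hb => ?_
  refine ⟨connectedComponentIn A a, connectedComponentIn_subset _ _, mem_connectedComponentIn ha,
    ?_, isPreconnected_connectedComponentIn⟩
  have hza := key a ha hz
  have hzb := key b hb hz
  obtain ⟨c, hcU, hca⟩ := mem_closure_iff_nhds.1 hza _ ((hUo z hz).mem_nhds (hzU z hz))
  obtain ⟨d, hdU, hdb⟩ := mem_closure_iff_nhds.1 hzb _ ((hUo z hz).mem_nhds (hzU z hz))
  have hSa : U z ∩ A ⊆ connectedComponentIn A a :=
    absorb (hUc z hz) inter_subset_right ⟨hcU, connectedComponentIn_subset _ _ hca⟩ hca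
  have hSb : U z ∩ A ⊆ connectedComponentIn A b :=
    absorb (hUc z hz) inter_subset_right ⟨hdU, connectedComponentIn_subset _ _ hdb⟩ hdb
  -- `d ∈ U z ∩ A` lies in both components
  have hd : d ∈ connectedComponentIn A a := hSa ⟨hdU, connectedComponentIn_subset _ _ hdb⟩
  rw [connectedComponentIn_eq hd, ← connectedComponentIn_eq hdb]
  exact mem_connectedComponentIn hb

/-- **The positive side of a connected regular zero set is preconnected** (apply the previous
result to `-F`). [cite: LeeSmoothManifolds2013, Prop. 5.47] -/
theorem isPreconnected_setOf_pos_of_isConnected_setOf_eq {F : EuclideanSpace ℝ (Fin (k + 1)) → ℝ}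
    (hF : ContDiff ℝ ∞ F) (hreg : ∀ x, F x = 0 → fderiv ℝ F x ≠ 0)
    (hZ : IsConnected {x | F x = 0}) :
    IsPreconnected {x : EuclideanSpace ℝ (Fin (k + 1)) | 0 < F x} := by
  have h := isPreconnected_setOf_lt_of_isConnected_setOf_eq (F := fun x => -F x) hF.neg
    (fun x hx => by
      have hx' : F x = 0 := by simpa using hx
      rw [show (fun x => -F x) = -F from rfl, fderiv_neg]
      simpa using hreg x hx')
    (by simpa using hZ)
  simpa using h

/-! ### Homeomorphisms carrying one regular zero set to another -/

/-- A regular zero of a smooth function is adherent to negative values: `{F < 0}` is nonempty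
as soon as `F` has a regular zero. [folklore] -/
theorem setOf_lt_nonempty_of_fderiv_ne_zero {F : EuclideanSpace ℝ (Fin (k + 1)) → ℝ}
    {z : EuclideanSpace ℝ (Fin (k + 1))} (hz : F z = 0) (hdz : fderiv ℝ F z ≠ 0) :
    {x | F x < 0}.Nonempty := by
  by_contra h
  have hmin : IsLocalMin F z := Filter.Eventually.of_forall fun x => by
    rw [hz]
    exact not_lt.1 fun hx => h ⟨x, hx⟩
  exact hdz (hmin.fderiv_eq_zero)

/-- The positive side `{0 < F}` of a function with compact sublevel set `{F ≤ 0}` on `ℝᵏ⁺¹` is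
unbounded. [folklore] -/
theorem not_isBounded_setOf_pos {F : EuclideanSpace ℝ (Fin (k + 1)) → ℝ}
    (hc : IsCompact {x | F x ≤ 0}) :
    ¬ Bornology.IsBounded {x : EuclideanSpace ℝ (Fin (k + 1)) | 0 < F x} := by
  intro hb
  have : Bornology.IsBounded (univ : Set (EuclideanSpace ℝ (Fin (k + 1)))) := by
    have hcov : (univ : Set (EuclideanSpace ℝ (Fin (k + 1)))) ⊆ {x | F x ≤ 0} ∪ {x | 0 < F x} :=
      fun x _ => (le_or_gt (F x) 0).elim Or.inl Or.inr
    exact (hc.isBounded.union hb).subset hcov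
  exact (NormedSpace.unbounded_univ ℝ (EuclideanSpace ℝ (Fin (k + 1)))) this

/-- **A homeomorphism of `ℝᵏ⁺¹` carrying the connected regular zero set `{F = 0}` onto the
regular zero set `{F' = 0}` carries the compact domain `{F ≤ 0}` onto the compact domain
`{F' ≤ 0}`.**  The connected set `θ {F < 0}` misses `{F' = 0}`, so it lies in `{F' < 0}` or in
`{0 < F'}`; likewise `θ {0 < F}`; the two images cover the complement of `{F' = 0}`, in which
both sides of `F'` are nonempty, so the images are exactly the two sides, and the bounded one,
`θ {F < 0}`, is the bounded side `{F' < 0}`. [cite: LeeSmoothManifolds2013, Prop. 5.47] -/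
theorem image_setOf_le_eq_of_image_setOf_eq_eq {F F' : EuclideanSpace ℝ (Fin (k + 1)) → ℝ}
    (hF : ContDiff ℝ ∞ F) (hreg : ∀ x, F x = 0 → fderiv ℝ F x ≠ 0)
    (hc : IsCompact {x | F x ≤ 0}) (hZ : IsConnected {x | F x = 0})
    (hF' : ContDiff ℝ ∞ F') (hreg' : ∀ x, F' x = 0 → fderiv ℝ F' x ≠ 0)
    (hc' : IsCompact {x | F' x ≤ 0})
    (θ : EuclideanSpace ℝ (Fin (k + 1)) ≃ₜ EuclideanSpace ℝ (Fin (k + 1)))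
    (hθ : θ '' {x | F x = 0} = {x | F' x = 0}) :
    θ '' {x | F x ≤ 0} = {x | F' x ≤ 0} := by
  -- notation for the sides
  set A := {x : EuclideanSpace ℝ (Fin (k + 1)) | F x < 0} with hA
  set B := {x : EuclideanSpace ℝ (Fin (k + 1)) | 0 < F x} with hB
  set Z := {x : EuclideanSpace ℝ (Fin (k + 1)) | F x = 0} with hZd
  set A' := {x : EuclideanSpace ℝ (Fin (k + 1)) | F' x < 0} with hA'
  set B' := {x : EuclideanSpace ℝ (Fin (k + 1)) | 0 < F' x} with hB'
  set Z' := {x : EuclideanSpace ℝ (Fin (k + 1)) | F' x = 0} with hZ'd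
  have hA'o : IsOpen A' := isOpen_lt hF'.continuous continuous_const
  have hB'o : IsOpen B' := isOpen_lt continuous_const hF'.continuous
  have hdisj' : Disjoint A' B' := by
    rw [Set.disjoint_left]
    intro x (hx : F' x < 0) (hx' : 0 < F' x)
    exact lt_asymm hx hx'
  -- the images of the sides of `F` miss `Z'` and together fill its complement
  have himZ : ∀ x, θ x ∈ Z' ↔ x ∈ Z := fun x => by
    rw [← hθ]; exact θ.injective.mem_set_image
  have hcover : ∀ S : Set (EuclideanSpace ℝ (Fin (k + 1))), (∀ x ∈ S, x ∉ Z) →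
      θ '' S ⊆ A' ∪ B' := by
    rintro S hS _ ⟨x, hx, rfl⟩
    have hx' : θ x ∉ Z' := fun h => hS x hx ((himZ x).1 h)
    rcases lt_trichotomy (F' (θ x)) 0 with h | h | h
    · exact Or.inl h
    · exact absurd h hx'
    · exact Or.inr h
  have hAZ : ∀ x ∈ A, x ∉ Z := fun x (hx : F x < 0) (h : F x = 0) => by
    rw [h] at hx; exact lt_irrefl _ hx
  have hBZ : ∀ x ∈ B, x ∉ Z := fun x (hx : 0 < F x) (h : F x = 0) => by
    rw [h] at hx; exact lt_irrefl _ hx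
  have hAim := (isPreconnected_setOf_lt_of_isConnected_setOf_eq hF hreg hZ).image θ
    θ.continuous.continuousOn
  have hBim := (isPreconnected_setOf_pos_of_isConnected_setOf_eq hF hreg hZ).image θ
    θ.continuous.continuousOn
  have hAss := hAim.subset_or_subset hA'o hB'o hdisj' (hcover A hAZ)
  have hBss := hBim.subset_or_subset hA'o hB'o hdisj' (hcover B hBZ)
  -- every point off `Z'` is the image of a point of `A` or of `B`
  have hsurj : ∀ y, y ∉ Z' → y ∈ θ '' A ∪ θ '' B := by
    intro y hy
    obtain ⟨x, rfl⟩ := θ.surjective y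
    have hx : x ∉ Z := fun h => hy ((himZ x).2 h)
    rcases lt_trichotomy (F x) 0 with h | h | h
    · exact Or.inl ⟨x, h, rfl⟩
    · exact absurd h hx
    · exact Or.inr ⟨x, h, rfl⟩
  -- both sides of `F'` are nonempty; `B'` is unbounded, `θ A` is bounded
  obtain ⟨z, hz⟩ := hZ.nonempty
  have hz' : θ z ∈ Z' := (himZ z).2 hz
  have hA'ne : A'.Nonempty := setOf_lt_nonempty_of_fderiv_ne_zero hz' (hreg' _ hz')
  have hB'nb : ¬ Bornology.IsBounded B' := not_isBounded_setOf_pos hc'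
  have hθAb : Bornology.IsBounded (θ '' A) :=
    (hc.image θ.continuous).isBounded.subset (image_mono fun x (hx : F x < 0) => hx.le)
  -- hence `θ A ⊆ A'`
  have hAA' : θ '' A ⊆ A' := by
    rcases hAss with h | h
    · exact h
    · exfalso
      -- then `θ B` covers `A'` (so `B' ⊆ θ A`, bounded) or both images lie in `B'`
      rcases hBss with h' | h'
      · -- `B' ⊆ θ A ∪ θ B ⊆ B' ∪ A'`; a point of `B'`... we show `B' ⊆ θ '' A`
        apply hB'nb
        refine hθAb.subset fun y hy => ?_
        have hyZ : y ∉ Z' := fun h'' => by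
          have : (0 : ℝ) < F' y := hy
          rw [show F' y = 0 from h''] at this; exact lt_irrefl _ this
        rcases hsurj y hyZ with hyA | hyB
        · exact hyA
        · exact absurd (h' hyB) (Set.disjoint_left.1 hdisj' · hy)
      · -- both images in `B'`: then `A'` is empty
        obtain ⟨y, hy⟩ := hA'ne
        have hyZ : y ∉ Z' := fun h'' => by
          have : F' y < 0 := hy
          rw [show F' y = 0 from h''] at this; exact lt_irrefl _ this
        rcases hsurj y hyZ with hyA | hyB
        · exact absurd (h hyA) (Set.disjoint_left.1 hdisj' hy)
        · exact absurd (h' hyB) (Set.disjoint_left.1 hdisj' hy)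
  -- and `θ B ⊆ B'`
  have hBB' : θ '' B ⊆ B' := by
    rcases hBss with h | h
    · exfalso
      -- both images inside `A'`: then `B'` is empty, but it is unbounded
      apply hB'nb
      refine (Bornology.isBounded_empty).subset fun y hy => ?_
      have hyZ : y ∉ Z' := fun h'' => by
        have : (0 : ℝ) < F' y := hy
        rw [show F' y = 0 from h''] at this; exact lt_irrefl _ this
      rcases hsurj y hyZ with hyA | hyB
      · exact absurd (hAA' hyA) (Set.disjoint_left.1 hdisj' · hy)
      · exact absurd (h hyB) (Set.disjoint_left.1 hdisj' · hy)
    · exact h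
  -- conclude: `θ {F ≤ 0} = {F' ≤ 0}`
  apply Subset.antisymm
  · rintro _ ⟨x, hx, rfl⟩
    rcases (show F x ≤ 0 from hx).lt_or_eq with h | h
    · have h1 : F' (θ x) < 0 := hAA' ⟨x, h, rfl⟩
      exact h1.le
    · have h1 : F' (θ x) = 0 := (himZ x).2 h
      exact h1.le
  · intro y hy
    rcases (show F' y ≤ 0 from hy).lt_or_eq with h | h
    · have hyZ : y ∉ Z' := fun h'' => by
        rw [show F' y = 0 from h''] at h; exact lt_irrefl _ h
      rcases hsurj y hyZ with ⟨x, hx, rfl⟩ | hyB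
      · exact ⟨x, (show F x < 0 from hx).le, rfl⟩
      · have h1 : 0 < F' y := hBB' hyB
        exact absurd h1 (lt_asymm h)
    · obtain ⟨x, hx, rfl⟩ : y ∈ θ '' Z := by rw [hθ]; exact h
      exact ⟨x, (show F x = 0 from hx).le, rfl⟩

end Literature.Topology.FourManifolds

end
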